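import Mathlib
import Summits.Ventures.PercRepro2.HubFibre

/-!
# Typed Harris for cluster events in the `typedCount` vocabulary (blind cell PercRepro2,
night-3 g5, 2026-08-25; `proofs/NIGHT3-CERT.md` §14.4 / §14.6)

For a root `a₁` and two marks `o, b`, the typed count of the SAME-copy kernel
`1[o ∈ C(a₁)](x) · 1[b ∈ C(a₁)](x)` dominates the typed count of the CROSS-copy kernel
`1[o ∈ C(a₁)](x) · 1[b ∈ C(a₁)](y)` on every minor and for every type map with values in
`{1, 2}` (`typedCount_cluster_harris`): the typed Harris inequality for the increasing cluster
events `{o ∈ C(a₁)}`, `{b ∈ C(a₁)}` — no conditioning on `Q`.  Proof: regroup by the third copy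
(`Hub.sum_tset_third`), turn the typed pairs over `w` into the DAD fibre (`Hub.sum_typed_fibre`),
and apply `DAD.fibreHarris` to the up-sets `{X | o ∈ C(cfg X, a₁)}`, `{X | b ∈ C(cfg X, a₁)}`
(typer-1's `fibre_block` with cluster events in place of hub patterns).  This is the
`S_same ≥ S_cross` half of the separated-class certificate of row 2′TRI.
-/

namespace Summit.Ventures.PercRepro2

open UnionCluster

namespace CovForm

namespace TypedHarris

open Hub

section Main

open Classical

variable {V : Type*} {E : Type*} [Fintype E] [DecidableEq E] {R : Type*} [Field R]
  [LinearOrder R] [IsStrictOrderedRing R]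
variable (ends : E → Sym2 V) (a₁ : V)

omit [Fintype E] [LinearOrder R] [IsStrictOrderedRing R] in
/-- `1[v ∈ C(a₁)]` at `cfg X` is the indicator of the up-set `{X | v ∈ C(cfg X, a₁)}`. -/
lemma iL_cfg_eq (v : V) (X : Finset E) :
    iL ends a₁ v (cfg X) =
      ({Y : Finset E | v ∈ cluster ends (cfg Y) a₁}).indicator (1 : Finset E → R) X := by
  unfold iL
  rw [Set.indicator_apply, Set.indicator_apply]
  simp only [mem_connEvent, Set.mem_setOf_eq, mem_cluster, Pi.one_apply]

omit [Fintype E] in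
/-- The cluster event of an edge set is an up-set. -/
lemma isUpperSet_clusterSet (v : V) :
    IsUpperSet {Y : Finset E | v ∈ cluster ends (cfg Y) a₁} :=
  fun _ _ hXY hX => cluster_mono (cfg_mono hXY) a₁ hX

/-- **Typed Harris for cluster events on one fibre**: over the typed pairs of `w`, the same-copy
count dominates the cross-copy count. -/
theorem fibre_cluster_harris (o b : V) (F : Finset E) (z : Config E) (τ : E → ℕ)
    (w : Config E) (hτ : ∀ e ∈ F, τ e = 1 ∨ τ e = 2) (hw : ∀ e, e ∉ F → w e = z e) :
    ∑ p ∈ pairSet F z τ w, (iL ends a₁ o p.1 : R) * iL ends a₁ b p.2 ≤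
      ∑ p ∈ pairSet F z τ w, (iL ends a₁ o p.1 : R) * iL ends a₁ b p.1 := by
  rw [sum_typed_fibre F z τ w hτ hw (fun x y => (iL ends a₁ o x : R) * iL ends a₁ b y),
    sum_typed_fibre F z τ w hτ hw (fun x _ => (iL ends a₁ o x : R) * iL ends a₁ b x)]
  have h := DAD.fibreHarris (R := R) (Aset F τ w) (Zset F z τ w) (Zset F z τ w)
    (disjoint_Zset_Aset F z τ w) (disjoint_Zset_Aset F z τ w)
    {Y : Finset E | o ∈ cluster ends (cfg Y) a₁} {Y : Finset E | b ∈ cluster ends (cfg Y) a₁}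
    (isUpperSet_clusterSet ends a₁ o) (isUpperSet_clusterSet ends a₁ b)
  simp only [Finset.union_self] at h
  refine le_trans (le_of_eq ?_) (h.trans (le_of_eq ?_))
  · refine Finset.sum_congr rfl fun r _ => ?_
    simp only [xOf, yOf, iL_cfg_eq]
  · refine Finset.sum_congr rfl fun r _ => ?_
    simp only [xOf, iL_cfg_eq]
    rw [Set.indicator_apply, Set.indicator_apply, Set.indicator_apply]
    simp only [Set.mem_inter_iff, Set.mem_setOf_eq, Pi.one_apply]
    by_cases ho : o ∈ cluster ends (cfg (Zset F z τ w ∪ r)) a₁ <;>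
      by_cases hb : b ∈ cluster ends (cfg (Zset F z τ w ∪ r)) a₁ <;> simp [ho, hb]

/-- The typed pairs over a third copy disagreeing with `z` off `F` are empty. -/
lemma pairSet_eq_empty (F : Finset E) (z : Config E) (τ : E → ℕ) (w : Config E)
    (hw : ¬ ∀ e, e ∉ F → w e = z e) : pairSet F z τ w = ∅ := by
  refine Finset.eq_empty_of_forall_notMem fun p hp => ?_
  have h := (Finset.mem_filter.1 hp).2
  exact hw fun e he => (h.1 e he).2.2

/-- **Typed Harris for cluster events**: the same-copy typed count of `{o ∈ C(a₁)} ∩ {b ∈ C(a₁)}`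
dominates the cross-copy one, on every minor and every type map with values in `{1, 2}`. -/
theorem typedCount_cluster_harris (o b : V) (F : Finset E) (z : Config E) (τ : E → ℕ)
    (hτ : ∀ e ∈ F, τ e = 1 ∨ τ e = 2) :
    typedCount F z τ (fun x y _ => (iL ends a₁ o x : R) * iL ends a₁ b y) ≤
      typedCount F z τ (fun x _ _ => (iL ends a₁ o x : R) * iL ends a₁ b x) := by
  rw [typedCount_eq_sum_tset, typedCount_eq_sum_tset, sum_tset_third, sum_tset_third]
  refine Finset.sum_le_sum fun w _ => ?_
  by_cases hw : ∀ e, e ∉ F → w e = z e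
  · exact fibre_cluster_harris ends a₁ o b F z τ w hτ hw
  · rw [pairSet_eq_empty F z τ w hw]
    simp

end Main

end TypedHarris

end CovForm

end Summit.Ventures.PercRepro2
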